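import Summits.PneNP.PneNP.Theorems.ChebyshevTracialDesignLevelCountObstruction
import HarnessLib

/-!
# Cell pnp-psdrank, route `ChebyshevTracialDesign`: one-signed weights are fooled in dimension `O(n²)`

Companion to the level-count obstruction (N3; planner p1 ROUND-1 §3 corollary (ii): "a certificate must charge levels with
BOTH signs"). If the weight `W : OddSet n → PMatch n → ℝ` is NONNEGATIVE, the Hadamard square `T = S∘S = (cc − 1)²` of the
odd-cut slack (`T ≥ S` entrywise on the integers, `T = 0` on the tight pairs) is a fooling matrix with an explicit psd
factorization of dimension `1 + |Sym2 (Fin n)| ≤ 2(n+1)²` (its Hadamard square root `S = cc − 1` is the inner product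
`⟨χ_U, 1_M⟩ − 1`; the `ℓ = 1` instance of the tensor-power linearisation of part 1 — in print: Lee–Theis 2012 Thm. 1 /
Fawzi–Gouveia–Parrilo–Robinson–Thomas §5.2, square-root rank). Hence (`oneSigned_obstruction`) there is a tight-orthogonal psd
rectangle of dimension `r ≤ 2(n+1)²` with normalised value `≥ ⟨W,S⟩/(8 (n+1)^6 (n^4+1))`, and (`not_tracialValueLEAt_of_nonneg`)
`TracialValueLEAt W γ r` fails there for every smaller `γ`: a hyperplane/tracial certificate with a one-signed weight excludes psd
factorizations of size `O(n²)` only, whatever its level structure — Rothvoß's `−μ_k/(k−1)` term is not optional.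
WHAT THIS IS NOT: not a psd-rank statement; a limit of one certificate template. Supports crux stmt-PneNP-19878 by delimiting it.
-/

set_option linter.dupNamespace false -- `Summit.PneNP.PneNP.…`: summit = sub-problem (D-0017)

noncomputable section

open scoped Classical MatrixOrder

namespace Summit.PneNP.PneNP.Theorems.ChebyshevTracialDesignLevelCount

open Finset Matrix Polynomial Literature.Barriers.PneNP Literature.Combinatorics.Optimization
  Literature.Computation.Certificates.SemidefiniteComplementarity

variable {n : ℕ}

/-! ### §1 The Hadamard square of the slack and its psd factorization of dimension `1 + |Sym2 (Fin n)|` -/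

/-- `⟨a_U, b_M⟩ = cc U M − 1` for the degree-`1` linearisation. -/
theorem aVec_dotProduct_bVec_one (U : OddSet n) (M : PMatch n) :
    aVec 1 (fun j : ℕ => if j = 0 then (-1 : ℝ) else 1) U ⬝ᵥ bVec 1 M = pmOddCutSlack n U M := by
  rw [aVec_dotProduct_bVec, pmOddCutSlack_apply, sum_range_succ, sum_range_succ, sum_range_zero]
  simp; ring

/-- **`S∘S` has a psd factorization of size `ρ(n,1) = 1 + |Sym2 (Fin n)|`** (rank-one factors). -/
theorem slackSq_hasPsdFactorization :
    HasPsdFactorization (fun (U : OddSet n) (M : PMatch n) => pmOddCutSlack n U M ^ 2) (dimN n 1) := by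
  set e := Fintype.equivFin (Idx n 1) with he
  set a : OddSet n → Fin (dimN n 1) → ℝ := fun U k => aVec 1 (fun j : ℕ => if j = 0 then (-1 : ℝ) else 1) U (e.symm k) with ha
  set b : PMatch n → Fin (dimN n 1) → ℝ := fun M k => bVec 1 M (e.symm k) with hb
  have hab : ∀ U M, a U ⬝ᵥ b M = pmOddCutSlack n U M := by
    intro U M
    rw [← aVec_dotProduct_bVec_one, ha, hb]
    unfold dotProduct
    exact Equiv.sum_comp e.symm (fun x => aVec 1 (fun j : ℕ => if j = 0 then (-1 : ℝ) else 1) U x * bVec 1 M x)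
  refine ⟨fun U => vecMulVec (a U) (a U), fun M => vecMulVec (b M) (b M),
    fun U => by simpa using posSemidef_vecMulVec_self_star (a U),
    fun M => by simpa using posSemidef_vecMulVec_self_star (b M), fun U M => ?_⟩
  show pmOddCutSlack n U M ^ 2 = _
  rw [vecMulVec_mul_vecMulVec, trace_vecMulVec, dotProduct_smul, smul_eq_mul, hab, sq]

/-- `ρ(n, 1) ≤ 2 (n+1)²`. -/
theorem dimN_one_le (n : ℕ) : (dimN n 1 : ℝ) ≤ 2 * ((n : ℝ) + 1) ^ 2 := by
  have := dimN_le n 1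
  norm_num at this
  linarith

/-- `S ≤ S∘S` entrywise (the slack is a natural number) and `S∘S ≤ n⁴`. -/
theorem slack_le_sq (U : OddSet n) (M : PMatch n) :
    pmOddCutSlack n U M ≤ pmOddCutSlack n U M ^ 2 ∧ pmOddCutSlack n U M ^ 2 ≤ (n : ℝ) ^ 4 + 1 := by
  have h1 := one_le_cc U M
  rw [pmOddCutSlack_apply]
  constructor
  · -- `(c - 1) ≤ (c - 1)²` for the natural number `c - 1`
    rcases Nat.eq_or_lt_of_le h1 with h | h
    · rw [← h]; simp
    · have : (2 : ℝ) ≤ cc U M := by exact_mod_cast h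
      nlinarith
  · have h2 := cc_sub_one_le U M
    have h0 : (0 : ℝ) ≤ (cc U M : ℝ) - 1 := by
      have : (1 : ℝ) ≤ cc U M := by exact_mod_cast h1
      linarith
    nlinarith [pow_le_pow_left₀ h0 h2 2]

/-! ### §2 The obstruction for nonnegative weights -/

/-- **One-signed weights are fooled in dimension `O(n²)`**: for `W ≥ 0` there is a tight-orthogonal psd rectangle of
dimension `r ≤ 2(n+1)²` with normalised tracial value `≥ ⟨W,S⟩ / (8 (n+1)^6 (n^4 + 1))`. -/
theorem oneSigned_obstruction (W : OddSet n → PMatch n → ℝ) (hW : ∀ U M, 0 ≤ W U M) :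
    ∃ r : ℕ, 0 < r ∧ (r : ℝ) ≤ 2 * ((n : ℝ) + 1) ^ 2 ∧
      ∃ (X : OddSet n → Matrix (Fin r) (Fin r) ℝ) (Y : PMatch n → Matrix (Fin r) (Fin r) ℝ),
        IsPsdRect X Y ∧
        (∑ U, ∑ M, W U M * pmOddCutSlack n U M) / (8 * ((n : ℝ) + 1) ^ 6 * ((n : ℝ) ^ 4 + 1))
          ≤ (∑ U, ∑ M, W U M * (X U * Y M).trace) / r := by
  set r := dimN n 1 with hr
  have hr0 : 0 < r := dimN_pos n 1
  have hr0' : (0 : ℝ) < r := by exact_mod_cast hr0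
  have hrle : (r : ℝ) ≤ 2 * ((n : ℝ) + 1) ^ 2 := dimN_one_le n
  have hΔ : (0 : ℝ) < (n : ℝ) ^ 4 + 1 := by positivity
  obtain ⟨X, Y, hX, hY, hT⟩ :=
    (slackSq_hasPsdFactorization (n := n)).rescale_weak hΔ (fun U M => (slack_le_sq U M).2)
  -- `⟨W, S⟩ ≤ ⟨W, S∘S⟩`
  have hWS : ∑ U, ∑ M, W U M * pmOddCutSlack n U M ≤ ∑ U, ∑ M, W U M * pmOddCutSlack n U M ^ 2 :=
    sum_le_sum fun U _ => sum_le_sum fun M _ => mul_le_mul_of_nonneg_left (slack_le_sq U M).1 (hW U M)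
  have hval : ∑ U, ∑ M, W U M * (X U * Y M).trace =
      (∑ U, ∑ M, W U M * pmOddCutSlack n U M ^ 2) / ((r : ℝ) ^ 2 * ((n : ℝ) ^ 4 + 1)) := by
    rw [eq_div_iff (by positivity), sum_mul]
    refine sum_congr rfl fun U _ => ?_
    rw [sum_mul]
    refine sum_congr rfl fun M _ => ?_
    have hT' : pmOddCutSlack n U M ^ 2 = ((dimN n 1 : ℕ) : ℝ) ^ 2 * ((n : ℝ) ^ 4 + 1) * (X U * Y M).trace := hT U M
    rw [hT']; ring
  refine ⟨r, hr0, hrle, X, Y, ⟨hX, hY, fun U M hcc => ?_⟩, ?_⟩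
  · -- tight-orthogonality: `S∘S = 0` on the tight pairs
    have h0 : pmOddCutSlack n U M ^ 2 = 0 := by rw [pmOddCutSlack_apply, hcc]; simp
    have hT' : pmOddCutSlack n U M ^ 2 = ((dimN n 1 : ℕ) : ℝ) ^ 2 * ((n : ℝ) ^ 4 + 1) * (X U * Y M).trace := hT U M
    rw [hT'] at h0
    have htr : (X U * Y M).trace = 0 := by
      rcases mul_eq_zero.1 h0 with h | h
      · exact absurd h (by positivity)
      · exact h
    exact (trace_mul_eq_zero_iff (hX U).1 (hY M).1).1 htr
  · rw [hval, div_div]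
    have hpos : 0 ≤ ∑ U, ∑ M, W U M * pmOddCutSlack n U M :=
      sum_nonneg fun U _ => sum_nonneg fun M _ => mul_nonneg (hW U M) (by
        have := one_le_cc U M
        rw [pmOddCutSlack_apply]
        have : (1 : ℝ) ≤ cc U M := by exact_mod_cast this
        linarith)
    have hden : (r : ℝ) ^ 2 * ((n : ℝ) ^ 4 + 1) * r ≤ 8 * ((n : ℝ) + 1) ^ 6 * ((n : ℝ) ^ 4 + 1) := by
      have hr3 : (r : ℝ) ^ 3 ≤ (2 * ((n : ℝ) + 1) ^ 2) ^ 3 := pow_le_pow_left₀ hr0'.le hrle 3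
      calc (r : ℝ) ^ 2 * ((n : ℝ) ^ 4 + 1) * r = (r : ℝ) ^ 3 * ((n : ℝ) ^ 4 + 1) := by ring
        _ ≤ (2 * ((n : ℝ) + 1) ^ 2) ^ 3 * ((n : ℝ) ^ 4 + 1) := mul_le_mul_of_nonneg_right hr3 hΔ.le
        _ = 8 * ((n : ℝ) + 1) ^ 6 * ((n : ℝ) ^ 4 + 1) := by ring
    calc (∑ U, ∑ M, W U M * pmOddCutSlack n U M) / (8 * ((n : ℝ) + 1) ^ 6 * ((n : ℝ) ^ 4 + 1))
        ≤ (∑ U, ∑ M, W U M * pmOddCutSlack n U M) / ((r : ℝ) ^ 2 * ((n : ℝ) ^ 4 + 1) * r) :=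
          div_le_div_of_nonneg_left hpos (by positivity) hden
      _ ≤ (∑ U, ∑ M, W U M * pmOddCutSlack n U M ^ 2) / ((r : ℝ) ^ 2 * ((n : ℝ) ^ 4 + 1) * r) :=
          div_le_div_of_nonneg_right hWS (by positivity)

/-- **Failure of tracial decay for one-signed weights**: for `W ≥ 0` and every `γ < ⟨W,S⟩/(8 (n+1)^6 (n^4+1))`, the hypothesis
`TracialValueLEAt W γ r` fails at some `r ≤ 2(n+1)²` — a one-signed certificate excludes psd factorizations of size `O(n²)` only. -/
theorem not_tracialValueLEAt_of_nonneg (W : OddSet n → PMatch n → ℝ) (hW : ∀ U M, 0 ≤ W U M) {γ : ℝ}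
    (hγ : γ < (∑ U, ∑ M, W U M * pmOddCutSlack n U M) / (8 * ((n : ℝ) + 1) ^ 6 * ((n : ℝ) ^ 4 + 1))) :
    ∃ r : ℕ, 0 < r ∧ (r : ℝ) ≤ 2 * ((n : ℝ) + 1) ^ 2 ∧ ¬ TracialValueLEAt W γ r := by
  obtain ⟨r, hr0, hrle, X, Y, hXY, hval⟩ := oneSigned_obstruction W hW
  exact ⟨r, hr0, hrle, fun h => by linarith [h X Y hXY]⟩

end Summit.PneNP.PneNP.Theorems.ChebyshevTracialDesignLevelCount

end
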